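import Literature.MathematicalPhysics.QuantumFieldTheory.Balaban1983to89.B9Eq316TowerFlatIsOneStep
import Literature.MathematicalPhysics.QuantumFieldTheory.Balaban1983to89.B9Eq319QprimeLipschitz

/-!
# `Balaban1983to89.B9Eq319QprimeTowerFlatSection` — T. Bałaban, *Propagators for lattice gauge theories in a background field*, Commun. Math. Phys. **99**
# (1985) 389–434 [Balaban1985BackgroundPropagators] (3.19) p. 393 with (3.11) p. 392 and [Balaban1984PropagatorsI] (1.18) p. 20: **THE BLOCK-CONSTANT
# EXTENSION IS A RIGHT INVERSE OF THE FLAT COMPOSITE GAUGE-PARAMETER AVERAGING `Q′_k(1)`, AND IT IS AN `ℓ²`-SCALING BY `√(c₀L^{kd})`** — `S♭_k f := f ∘ (block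
# coordinate of side L^k)`, `Q′_k(1)(S♭_k f) = f`, `‖S♭_k f‖²_{L²(c₀)} = c₀·L^{kd}·Σ_y ‖f(y)‖²` (an `ℓ²`-ISOMETRY along print's `c₀L^{kd} = (ηL^k)^d = 1`) — versus
# this lineage's CENTRE extension (`B9Eq319QprimeTowerCentre`, a section for EVERY `U`, mass `c₀L^{2kd}Σ‖f‖²`, i.e. `L^{kd∕2}`× larger in norm)

statement-level skeleton of published theorems with citation tags; proofs where landed; nothing here is a claim about the Yang–Mills mass gap

PDF held: `paper:balaban1985-cmp99-background-propagators` (journal page = PDF page + 388) p. 393 (text layer p0005, read by this seat 2026-08-22): *«(Q′(V)λ)(y)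
= Σ_{x∈B(y)} L^{−d} R(V(Γ_{y,x}))λ(x)»*, *«Q′_j(U) = Q′(Ū^{j−1}) … Q′(U) (3.19)»*; [B5] (1.18) p. 20 through `B9Eq316TowerFlatIsOneStep` (the flat `k`-fold
composite IS one block mean of side `L^k`).  A right inverse of `Q′` is NOT in print (print uses «Q′ onto» only); this is the cell's [folklore] device.

WHY THIS FILE (cell context; OFFER O-ne9leaf02-g64-3 (b) of the pub-balaban NE9 crux team).  The host `B9Thm311SmallFieldCoercivityTower.
exists_coercive_principalk_of_small_field` displays sections `S₁` of `Q′_k(1)` and `S₂` of `Q′_k(U)` with ONE sup→`L²` constant `CS`; this lineage's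
gen-62∕63 files inhabit both by the CENTRE extension with `CS = (L^d)^k√(c₀#T_m) = L^{kd∕2}√#T_m` along (3.11).  For the FLAT `Q′_k(1)` the natural
section is the block-CONSTANT extension, whose `L²(c₀)` mass is `c₀L^{kd}Σ_y‖f y‖²` — `L^{kd}` times SMALLER than the centre extension's, an
`ℓ²`-isometry on print's diagonal; with the `ℓ²` tower letter `ρ′_k` of `B9Eq319QprimeTowerLipschitzL2` it makes the host's product `CS·ρ′` free of
`L^{kd}` once the host measures the coarse datum in `ℓ²` (journal ASK (d)); a section of `Q′_k(U)` then follows by a Neumann series (O-3 (c)).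

WHAT IS PROVED (sorry-free; proof lane — no `def`, no `Prop` placeholder, no inequality of the papers asserted).
* §1 ONE STEP on any torus `T_{LP} → T_P`: `sum_blockOf_smul_comp_blockCoord` (the flat block mean of `f ∘ blockCoord` returns `f`: `|B(y)| = L^d`),
  **`QprimeLin_flat_comp_blockCoord`** (`Q′(1)(f ∘ blockCoord) = f`), **`sum_norm_sq_comp_blockCoord`** (`Σ_x ‖f(blockCoord x)‖² = L^d·Σ_y ‖f y‖²`).
* §2 THE TOWER (via the owner's `B9Eq316TowerFlatIsOneStep.QprimeTowerW_one_eq_oneStep` at block size `L^{n+1}`):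
  **`exists_QprimeTowerW_one_flatSection`** — `∃ S : (TSite d m → W) →ₗ[ℂ] SiteL2K ℂ d (towerP L m (n+1)) c₀ W` with `Q′_{n+1}(1)(S f) = f` for EVERY
  fibre reading `φ`, the VOLUME-FREE identity `‖S f‖² = c₀·(L^{n+1})^d·Σ_y ‖f y‖²`, and (for the host's CURRENT sup currency) `‖S f‖ ≤ √(c₀(L^{n+1})^d·#T_m)·‖f‖_∞`
  (`= √#T_m` on the diagonal — the host's `S₁` slot with `CS` smaller by `L^{kd∕2}` than gen 62's).
MODEL ∕ HONEST SCOPE.  [folklore] finite-lattice linear algebra on the owner's identification; a section of the FLAT `Q′_k(1)` only (not of `Q′_k(U)` — that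
is O-3 (c)); nothing of [B9] Thms 3.1–3.13 asserted; NOT summit progress (cell pub-balaban: NE9 NOT PRINTED ∕ NOT PROVED, «NE9 ⇐ the named binders»; row
WALLED ON A MODEL; spine PROVED 0∕9; rung (B)+1 finite T⁴ — NOT infinite volume, NOT mass gap, NOT Clay; HONEST DEPENDENCY: continuum YM on T⁴ ⇐ BetaPertH ∧
nine spine estimates (0/9 proved); BetaPertH ⇐ (D1) ∧ (D4) ∧ CAP+tail; G-an2-4 gates asym, D1 and NE2/3/4).  Filed by the NE9 crux-team leaf seat
`b2b-balaban-t4-ne9-formalise-leaf-02` (gen 64); NEW file importing `B9Eq316TowerFlatIsOneStep` and `B9Eq319QprimeLipschitz`; nothing modified.  Net new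
unproved facts: 0.
-/

noncomputable section

open scoped BigOperators

namespace Literature.MathematicalPhysics.QuantumFieldTheory.Balaban1983to89.B9Eq319QprimeTowerFlatSection

open B4Sect5Torus (TSite)
open B9SectCLatticeCarrier (Bond)
open B9Eq311L2Pairing (WL2)
open B11Eq103H1Complex (SiteL2K)
open B9Eq319QprimeTorus (fineP blockCoord mem_blockOf_iff QprimeLin)
open B9Eq319QprimeLipschitz (QprimeLin_flat_apply sum_blockOf_sum QprimeW_one_apply)
open B5Eq172FlatCoercivity (card_blockOf)
open B9Eq315QTower (towerP)
open B9Eq326OperatorAssembly (QprimeW)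
open B9Eq326OperatorTower (QprimeTowerW)
open B9Eq316TowerFlatIsOneStep (towerP_eq_fineP_pow siteL2Cast norm_siteL2Cast equiv_siteL2Cast QprimeTowerW_one_eq_oneStep)

variable {d : ℕ} (L : ℕ) [NeZero L]

/-! ## §1 One step: the block-constant extension `f ∘ blockCoord` -/

section OneStep

variable (P : Fin d → ℕ) {V : Type*} [NormedAddCommGroup V] [NormedSpace ℂ V]

/-- The flat block mean of `f ∘ blockCoord` at `y` is `f y` (all `L^d` sites of `B(y)` carry `f y`). [folklore] [cite: Balaban1985BackgroundPropagators, (3.19) p.393; Balaban1985Averaging, (2)–(4) pp.17–18] -/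
theorem sum_blockOf_smul_comp_blockCoord (f : TSite d P → V) (y : TSite d P) :
    ∑ x ∈ B9Eq319QprimeTorus.blockOf L P y, ((L : ℝ) ^ d)⁻¹ • f (blockCoord L P x) = f y := by
  have hL : (0 : ℝ) < (L : ℝ) ^ d := by
    have : (0 : ℝ) < L := by exact_mod_cast Nat.pos_of_ne_zero (NeZero.ne L)
    positivity
  calc ∑ x ∈ B9Eq319QprimeTorus.blockOf L P y, ((L : ℝ) ^ d)⁻¹ • f (blockCoord L P x) = ∑ _x ∈ B9Eq319QprimeTorus.blockOf L P y, ((L : ℝ) ^ d)⁻¹ • f y :=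
        Finset.sum_congr rfl fun x hx => by rw [(mem_blockOf_iff L P y x).1 hx]
    _ = f y := by
        rw [Finset.sum_const, card_blockOf, ← Nat.cast_smul_eq_nsmul ℝ, smul_smul, Nat.cast_pow, mul_inv_cancel₀ hL.ne', one_smul]

/-- **`Q′(1)(f ∘ blockCoord) = f`**: the block-constant extension is a right inverse of the FLAT one-step gauge-parameter averaging.
[cite: Balaban1985BackgroundPropagators, (3.19) p.393] -/
theorem QprimeLin_flat_comp_blockCoord (f : TSite d P → V) :
    QprimeLin L P (fun _ : Bond d (fineP L P) => (LinearMap.id : V →ₗ[ℂ] V)) (f ∘ blockCoord L P) = f := by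
  funext y
  rw [QprimeLin_flat_apply]
  exact sum_blockOf_smul_comp_blockCoord L P f y

omit [NormedSpace ℂ V] [NeZero L] in
/-- **`Σ_x ‖f(blockCoord x)‖² = L^d·Σ_y ‖f y‖²`** — the block-constant extension is an `ℓ²`-SCALING by `√(L^d)` (the blocks partition the fine torus,
`|B(y)| = L^d`). [folklore] [cite: Balaban1985Averaging, (2)–(4) pp.17–18] -/
theorem sum_norm_sq_comp_blockCoord [NeZero L] (f : TSite d P → V) :
    ∑ x : TSite d (fineP L P), ‖f (blockCoord L P x)‖ ^ 2 = (L : ℝ) ^ d * ∑ y : TSite d P, ‖f y‖ ^ 2 := by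
  rw [← sum_blockOf_sum L P (fun x => ‖f (blockCoord L P x)‖ ^ 2), Finset.mul_sum]
  refine Finset.sum_congr rfl fun y _ => ?_
  calc ∑ x ∈ B9Eq319QprimeTorus.blockOf L P y, ‖f (blockCoord L P x)‖ ^ 2 = ∑ _x ∈ B9Eq319QprimeTorus.blockOf L P y, ‖f y‖ ^ 2 :=
        Finset.sum_congr rfl fun x hx => by rw [(mem_blockOf_iff L P y x).1 hx]
    _ = (L : ℝ) ^ d * ‖f y‖ ^ 2 := by rw [Finset.sum_const, card_blockOf, nsmul_eq_mul, Nat.cast_pow]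

end OneStep

/-! ## §2 The tower: a volume-free section of the flat `Q′_{n+1}(1)` on the `L²` carrier -/

section Tower

variable {𝔸 : Type*} [NormedRing 𝔸] [NormedAlgebra ℂ 𝔸] [CompleteSpace 𝔸]
  (m : Fin d → ℕ) [∀ i, NeZero (m i)] (n : ℕ)
  {W : Type*} [NormedAddCommGroup W] [InnerProductSpace ℂ W] {c₀ : ℝ} [Fact (0 < c₀)]

/-- **THE BLOCK-CONSTANT SECTION OF THE FLAT `Q′_{n+1}(1)`** — there is ONE `ℂ`-linear `S : (T_m → W) → L²(T_{L^{n+1}m}; c₀; W)` (the extension constant on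
the blocks of side `L^{n+1}`, read through the owner's identification `Q′_{n+1}(1) = Q′^{(L^{n+1})}(1) ∘ Φ′`) with `Q′_{n+1}(1)(S f) = f` for EVERY fibre reading
`φ`, the VOLUME-FREE identity `‖S f‖² = c₀·(L^{n+1})^d·Σ_y ‖f y‖²` (an `ℓ²`-isometry along `c₀(L^{n+1})^d = 1`), and the sup-currency bound
`‖S f‖ ≤ √(c₀(L^{n+1})^d·#T_m)·‖f‖_∞`. [cite: Balaban1985BackgroundPropagators, (3.19) p.393, (3.11) p.392; Balaban1984PropagatorsI, (1.18) p.20] -/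
theorem exists_QprimeTowerW_one_flatSection :
    ∃ S : (TSite d m → W) →ₗ[ℂ] SiteL2K ℂ d (towerP L m (n + 1)) c₀ W,
      (∀ (φ : W ≃ₗ[ℂ] 𝔸) (f : TSite d m → W),
          QprimeTowerW L m n φ (fun _ : Bond d (towerP L m (n + 1)) => (1 : 𝔸ˣ)) (c₀ := c₀) (S f) = f) ∧
      (∀ f : TSite d m → W, ‖S f‖ ^ 2 = c₀ * ((L : ℝ) ^ (n + 1)) ^ d * ∑ y : TSite d m, ‖f y‖ ^ 2) ∧
      ∀ f : TSite d m → W, ‖S f‖ ≤ Real.sqrt (c₀ * ((L : ℝ) ^ (n + 1)) ^ d * Fintype.card (TSite d m)) * ‖f‖ := by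
  have hc₀ : 0 < c₀ := Fact.out
  have h := towerP_eq_fineP_pow L m (n + 1)
  -- the block-constant extension at block size `L^{n+1}`, read on the `L²` synonym, then cast to the tower typing
  let E : (TSite d m → W) →ₗ[ℂ] (TSite d (fineP (L ^ (n + 1)) m) → W) := LinearMap.funLeft ℂ W (blockCoord (L ^ (n + 1)) m)
  let S : (TSite d m → W) →ₗ[ℂ] SiteL2K ℂ d (towerP L m (n + 1)) c₀ W :=
    (siteL2Cast ℂ h).symm.toLinearMap ∘ₗ (WL2.linearEquiv ℂ ℂ (fun _ : TSite d (fineP (L ^ (n + 1)) m) => c₀)).symm.toLinearMap ∘ₗ E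
  have hSE : ∀ f, siteL2Cast ℂ h (S f) = (WL2.linearEquiv ℂ ℂ (fun _ : TSite d (fineP (L ^ (n + 1)) m) => c₀)).symm (E f) := fun f => by
    simp only [S, LinearMap.comp_apply, LinearEquiv.coe_toLinearMap, LinearEquiv.apply_symm_apply]
  have hEf : ∀ f x, E f x = f (blockCoord (L ^ (n + 1)) m x) := fun f x => rfl
  -- the volume-free mass identity
  have hmass : ∀ f : TSite d m → W, ‖S f‖ ^ 2 = c₀ * ((L : ℝ) ^ (n + 1)) ^ d * ∑ y : TSite d m, ‖f y‖ ^ 2 := fun f => by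
    have hn : ‖S f‖ = ‖siteL2Cast ℂ h (S f)‖ := (norm_siteL2Cast ℂ h (S f)).symm
    rw [hn, hSE, WL2.norm_sq (𝕜 := ℂ) (w := fun _ : TSite d (fineP (L ^ (n + 1)) m) => c₀) (V := W)]
    simp only [WL2.linearEquiv_symm_apply, Equiv.apply_symm_apply, hEf]
    rw [← Finset.mul_sum, sum_norm_sq_comp_blockCoord (L ^ (n + 1)) m f, Nat.cast_pow, mul_assoc]
  refine ⟨S, fun φ f => ?_, hmass, fun f => ?_⟩
  · rw [QprimeTowerW_one_eq_oneStep L m n φ h, LinearMap.comp_apply, LinearEquiv.coe_toLinearMap, hSE]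
    funext y
    rw [QprimeW_one_apply]
    have key := sum_blockOf_smul_comp_blockCoord (L ^ (n + 1)) m f y
    simp only [Nat.cast_pow] at key
    simpa only [WL2.linearEquiv_apply, WL2.linearEquiv_symm_apply, Equiv.apply_symm_apply, hEf, Nat.cast_pow] using key
  · have hsum : ∑ y : TSite d m, ‖f y‖ ^ 2 ≤ Fintype.card (TSite d m) * ‖f‖ ^ 2 := by
      calc ∑ y : TSite d m, ‖f y‖ ^ 2 ≤ ∑ _y : TSite d m, ‖f‖ ^ 2 :=
            Finset.sum_le_sum fun y _ => pow_le_pow_left₀ (norm_nonneg _) (norm_le_pi_norm f y) 2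
        _ = Fintype.card (TSite d m) * ‖f‖ ^ 2 := by rw [Finset.sum_const, Finset.card_univ, nsmul_eq_mul]
    have hsq : ‖S f‖ ^ 2 ≤ (Real.sqrt (c₀ * ((L : ℝ) ^ (n + 1)) ^ d * Fintype.card (TSite d m)) * ‖f‖) ^ 2 := by
      rw [hmass, mul_pow, Real.sq_sqrt (by positivity)]
      have h0 : 0 ≤ c₀ * ((L : ℝ) ^ (n + 1)) ^ d := by positivity
      nlinarith [mul_le_mul_of_nonneg_left hsum h0]
    exact (pow_le_pow_iff_left₀ (norm_nonneg _) (by positivity) two_ne_zero).1 hsq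

end Tower

end Literature.MathematicalPhysics.QuantumFieldTheory.Balaban1983to89.B9Eq319QprimeTowerFlatSection

end
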